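import Summits.BirchSwinnertonDyer.BirchSwinnertonDyer.Theorems.ClassRecordThreeEulerHalvesAtThreeCartanCarayolLift
import Summits.BirchSwinnertonDyer.BirchSwinnertonDyer.Theorems.ClassRecordThreeEulerHalvesAtThreeCartanCarayolEigenCochain
import Summits.BirchSwinnertonDyer.BirchSwinnertonDyer.Theorems.ClassRecordThreeEulerHalvesAtThreeCartanCoverHeckePeriodEquivariance
import Literature.NumberTheory.Automorphic.FuchsianEichlerShimuraWeightTwo
import Literature.NumberTheory.Automorphic.QuaternionOrderHeckeOperatorCuspForms
import Literature.NumberTheory.EllipticCurves.GreenbergSelmerOrdinaryFiltrationProofs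
import HarnessLib

/-!
# (LIFT′) from its four print inputs: `ESᶜ → SIGᶜ → JLᶜ → COMMᶜ → CartanCarayol.CuspidalEigenCochainLiftPrimeToCartanPlaceAtThree`

Theorems only. The kernel assembly of (LIFT′) (`ClassRecordThreeEulerHalvesAtThreeCartanCarayolLift.lean`; route `ClassRecordThree`, crux
`EulerHalvesAtThree`, item `stmt-BirchSwinnertonDyer-19109`; (LIFT′) → (EIG′) → (OBS) is `CartanCarayol.noModThreePeriodCharacterExtension_of_cuspLift`,
and (LIFT′) is the last non-cite node of line `Lines/lattice` of crux `CartanOnePlaceDegreeLawAtThree`) from the four NAMED FACTS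

* (ESᶜ) `Literature.NumberTheory.Automorphic.eichlerShimura_weightTwo_rePeriod` — Shimura Thm. 8.4: `φ : S₂(Γ′) ≅ Hom_par(Γ′, ℝ)`;
* (SIGᶜ) `Literature.NumberTheory.Automorphic.parabolicCochain_free_and_modLift` — `Hom_par(Γ′, ℤ)` is free of finite rank, mod-`n` lifting;
* (JLᶜ) `Literature.NumberTheory.Automorphic.jacquetLanglands_cartanCover_newform` (through `.exists_newform1`) — an eigenform of the good `T_ℓ`
  on `S₂(Γ′)` has the eigenvalues of a newform of level `∣ D·M·∏_{C∖q} p²` and trivial character;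
* (COMMᶜ) `Literature.NumberTheory.Automorphic.unitsHeckeFun_comm_cartanCover` — the good `T_ℓ` commute on `S₂(Γ′)`;

and TREE THEOREMS: (H1) `exists_linearMap_coe_eq_unitsHeckeFun` ∕ `finite_quotient_unitsHeckeSetoid_of_cover` (`T_ℓ ∈ End_ℂ S₂(Γ′)`,
`QuaternionOrderHeckeOperatorCuspForms.lean`), (H2) `InertHecke.segmentIntegral_unitsHeckeFun_eq_sum` (the Hecke–period identity
`∫_{z₀}^{γz₀} T_ℓ F = Σ_i ∫_{z₀}^{α_i γ α_{σ i}⁻¹ z₀} F`, `…CartanCoverHeckePeriodEquivariance.lean`),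
`CartanCarayol.exists_zmod_three_cochain_of_package`
(a scalar `ψ : Γ′ → 𝔽₃` out of the `A`-valued package), `CartanCarayol.exists_eigenCochain_lift_of_eigenCochain_mod_three` (Deligne–Serre on the
`T_ℓ`-stable lattice `Hom_par(Γ′, ℤ)`: a complex joint eigen-cochain `v ≠ 0` with eigenvalues `σ(t_ℓ)` in an order `R ↪ ℂ` reducing to `a_ℓ` at a
place over `3`), `exists_maximal_ideal_over_ker` (the number-field bookkeeping of the sibling `TameQuarticManinParity…LiftsToNewform`).

Chain: the commutation of the `T_ℓ` on integer cochains is READ OFF (COMMᶜ) through (ESᶜ)+(H1)+(H2) (`φ` is injective and intertwines);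
`ψ` lifts to `u ∈ Hom_par(Γ′, ℤ)` by (SIGᶜ)(ii); Deligne–Serre gives `v`; `v = v₁ + i v₂ ↦ G = F₁ + i F₂` by (ESᶜ) (surjectivity on
`Hom_par(Γ′, ℝ)`, twice) is a `T_ℓ`-eigenform with eigenvalues `σ(t_ℓ)` — or, if `G = 0`, `F₁ ≠ 0` is one with the conjugate eigenvalues
`conj ∘ σ` —; (JLᶜ) gives the newform `f` with `a_ℓ(f) = τ(t_ℓ)`; `ℤ[t_ℓ : ℓ good] ⊆ R` is a finite `ℤ`-algebra embedded in `K_f` by `τ`, and a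
maximal ideal `𝔐 ∋ 3` of `𝓞_{K_f}` over `ker(R → 𝔽₃)` gives `k = 𝓞_{K_f}/𝔐` with `X² − a_ℓ(f)X + ℓ ↦ X² − a_ℓ X + ℓ (mod 𝔐)` at all
good `ℓ`.

## References
* [ShimuraIATAF1971] G. Shimura, *Introduction to the arithmetic theory of automorphic functions* (1971), Thm. 8.4, § 8.3 (8.3.2), Prop. 8.5, Thm. 3.51.
* [DeligneSerre1974] P. Deligne, J.-P. Serre, *Formes modulaires de poids 1*, Ann. Sci. ÉNS 7 (1974), Lemme 6.11.
* [DiamondShurman2005] F. Diamond, J. Shurman, *A first course in modular forms*, GTM 228, Thm. 6.5.1, Prop. 5.8.5.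
* [AtiyahMacdonald1969] M. Atiyah, I. Macdonald, *Introduction to commutative algebra*, Thm. 5.10.
-/

set_option linter.dupNamespace false

noncomputable section

open scoped Classical MatrixGroups ModularForm NumberField UpperHalfPlane

namespace Summit.BirchSwinnertonDyer.BirchSwinnertonDyer.Theorems.CartanCarayol

open Summit.BirchSwinnertonDyer.BirchSwinnertonDyer.Theorems
open Summit.BirchSwinnertonDyer.BirchSwinnertonDyer.Theorems.CartanCover.Charext
open Literature.NumberTheory.Automorphic Literature.NumberTheory.EllipticCurves.ModularForms Literature.NumberTheory.ModularSymbols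
open CongruenceSubgroup Polynomial

/-! ## § 1 Small lemmas -/

section Small

variable {Γ : Subgroup (GL (Fin 2) ℝ)}

/-- `φ(0) = 0`. [folklore] -/
theorem rePeriod_zero (z₀ : ℍ) (γ : Γ) : CuspForm.rePeriod (0 : CuspForm Γ 2) z₀ γ = 0 := by
  have h := CuspForm.rePeriod_add (0 : CuspForm Γ 2) 0 z₀ γ
  rw [add_zero] at h
  linarith

/-- `φ(F − G) = φ(F) − φ(G)`. [folklore] -/
theorem rePeriod_sub (F G : CuspForm Γ 2) (z₀ : ℍ) (γ : Γ) :
    CuspForm.rePeriod (F - G) z₀ γ = CuspForm.rePeriod F z₀ γ - CuspForm.rePeriod G z₀ γ := by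
  have h : F - G = F + (-1 : ℝ) • G := by
    ext z
    simp [sub_eq_add_neg]
  rw [h, CuspForm.rePeriod_add, CuspForm.rePeriod_smul]
  ring

/-- injectivity of `φ` in the form «equal periods ⟹ equal forms». [folklore] -/
theorem eq_of_forall_rePeriod_eq {z₀ : ℍ} (hinj : ∀ F : CuspForm Γ 2, (∀ γ, CuspForm.rePeriod F z₀ γ = 0) → F = 0) {F G : CuspForm Γ 2}
    (h : ∀ γ, CuspForm.rePeriod F z₀ γ = CuspForm.rePeriod G z₀ γ) : F = G :=
  sub_eq_zero.mp (hinj _ fun γ ↦ by rw [rePeriod_sub, h, sub_self])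

end Small

/-- a prime dividing the newform level `M_f ∣ D·M·∏_{C∖q} p²` divides `q·D·M·∏_C p`. [folklore] -/
theorem dvd_of_dvd_newformLevel {D M q ℓ Mf : ℕ} {C : Finset ℕ} (hℓ : ℓ.Prime) (hMf : Mf ∣ D * M * ∏ p ∈ C.erase q, p ^ 2) (h : ℓ ∣ Mf) :
    ℓ ∣ q * (D * M * ∏ p ∈ C, p) := by
  have hℓ' := Nat.prime_iff.mp hℓ
  rcases hℓ'.dvd_or_dvd (h.trans hMf) with h2 | h2
  · exact Dvd.dvd.mul_left (Dvd.dvd.mul_right h2 _) _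
  · obtain ⟨p, hp, hp2⟩ := (Prime.dvd_finsetProd_iff hℓ' _).mp h2
    have h3 : ℓ ∣ ∏ p ∈ C, p := (hℓ'.dvd_of_dvd_pow hp2).trans (Finset.dvd_prod_of_mem _ (Finset.mem_of_mem_erase hp))
    exact Dvd.dvd.mul_left (Dvd.dvd.mul_left h3 _) _

/-! ## § 2 The assembly -/

/-- **(LIFT′) FROM ITS FOUR PRINT INPUTS.** `ESᶜ → SIGᶜ → JLᶜ → COMMᶜ → CuspidalEigenCochainLiftPrimeToCartanPlaceAtThree` (module docstring for the
chain; (H1), (H2), Deligne–Serre and the bookkeeping are tree theorems). [ShimuraIATAF1971, Thm. 8.4, § 8.3, Prop. 8.5, Thm. 3.51] [DeligneSerre1974, Lemme 6.11]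
[folklore: assembly] -/
theorem cuspidalEigenCochainLift_of_facts (hES : eichlerShimura_weightTwo_rePeriod) (hSIG : parabolicCochain_free_and_modLift)
    (hJL : jacquetLanglands_cartanCover_newform) (hCOMM : unitsHeckeFun_comm_cartanCover) :
    CuspidalEigenCochainLiftPrimeToCartanPlaceAtThree := by
  intro D M C X q _ hq A _ χ a S hadd h3 hne hfin hpar hhecke
  classical
  -- § the cover group `Γ′ := CartanCover.coverUnits X q`, the cover order, the good primes
  haveI : (CartanCover.coverUnits X q).HasDetOne := hasDetOne_normOneUnits X.ι (CartanCover.isOrder_coverOrder X q)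
  have hO' : Brandt.IsOrder X.B (X.O ⊔ X.O₀.map ((((∏ p ∈ C.erase q, p : ℕ) : ℤ)) • LinearMap.id)) := CartanCover.isOrder_coverOrder X q
  have hqp : q.Prime := Fact.out
  have hN0 : q * (D * M * ∏ p ∈ C, p) ≠ 0 := by
    have hDM : D * M ≠ 0 := fun h ↦ (X.coprime q hq).2 (h ▸ dvd_zero q)
    exact mul_ne_zero hqp.ne_zero (mul_ne_zero hDM (Finset.prod_ne_zero_iff.mpr fun p hp ↦ (X.coprime p hp).1.ne_zero))
  set S₁ : Finset ℕ := S ∪ (q * (D * M * ∏ p ∈ C, p)).primeFactors with hS₁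
  set P : Set ℕ := {ℓ | ℓ.Prime ∧ ℓ ∉ S₁} with hP
  have hPgood : ∀ ℓ ∈ P, ℓ.Prime ∧ ℓ ∉ S ∧ ¬ ℓ ∣ q * (D * M * ∏ p ∈ C, p) := fun ℓ hℓ ↦
    ⟨hℓ.1, fun h ↦ hℓ.2 (Finset.mem_union_left _ h),
      fun h ↦ hℓ.2 (Finset.mem_union_right _ (Nat.mem_primeFactors.mpr ⟨hℓ.1, h, hN0⟩))⟩
  -- § the print inputs, specialised to `Γ′` (definitional unfolding of `coverUnits` ∕ `coverOrder`)
  have hES' : (∀ F : CuspForm (CartanCover.coverUnits X q) 2, (∀ γ : (CartanCover.coverUnits X q), CuspForm.rePeriod F UpperHalfPlane.I γ = 0) → F = 0) ∧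
      ∀ w : (CartanCover.coverUnits X q) → ℝ, (∀ γ δ : (CartanCover.coverUnits X q), w (γ * δ) = w γ + w δ) →
        (∀ γ : (CartanCover.coverUnits X q), (γ : GL (Fin 2) ℝ).IsParabolic → w γ = 0) →
        ∃ F : CuspForm (CartanCover.coverUnits X q) 2, ∀ γ : (CartanCover.coverUnits X q), CuspForm.rePeriod F UpperHalfPlane.I γ = w γ :=
    hES X.B (CartanCover.coverOrder X q) (CartanCover.isOrder_coverOrder X q) X.ι X.ι_injective UpperHalfPlane.I
  obtain ⟨hESinj, hESsurj⟩ := hES'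
  have hSIG' : (∃ (r : ℕ) (e : Fin r → ((CartanCover.coverUnits X q) → ℤ)),
      (∀ i, (∀ γ δ : (CartanCover.coverUnits X q), e i (γ * δ) = e i γ + e i δ) ∧
        (∀ γ : (CartanCover.coverUnits X q), (γ : GL (Fin 2) ℝ).IsParabolic → e i γ = 0)) ∧
      ∀ u : (CartanCover.coverUnits X q) → ℤ, (∀ γ δ : (CartanCover.coverUnits X q), u (γ * δ) = u γ + u δ) →
        (∀ γ : (CartanCover.coverUnits X q), (γ : GL (Fin 2) ℝ).IsParabolic → u γ = 0) →
        ∃! c : Fin r → ℤ, u = fun γ => ∑ i, c i * e i γ) ∧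
      (∀ (n : ℕ), n ≠ 0 → ∀ ψ : (CartanCover.coverUnits X q) → ZMod n, (∀ γ δ : (CartanCover.coverUnits X q), ψ (γ * δ) = ψ γ + ψ δ) →
        (∀ γ : (CartanCover.coverUnits X q), IsOfFinOrder γ → ψ γ = 0) →
        (∀ γ : (CartanCover.coverUnits X q), (γ : GL (Fin 2) ℝ).IsParabolic → ψ γ = 0) →
        ∃ u : (CartanCover.coverUnits X q) → ℤ, (∀ γ δ : (CartanCover.coverUnits X q), u (γ * δ) = u γ + u δ) ∧
          (∀ γ : (CartanCover.coverUnits X q), (γ : GL (Fin 2) ℝ).IsParabolic → u γ = 0) ∧ ∀ γ : (CartanCover.coverUnits X q), (u γ : ZMod n) = ψ γ) :=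
    hSIG X.B (CartanCover.coverOrder X q) (CartanCover.isOrder_coverOrder X q) X.ι X.ι_injective
  obtain ⟨⟨r, b, hb, huniq⟩, hlift⟩ := hSIG'
  have hJL' : ∀ (F : CuspForm (CartanCover.coverUnits X q) 2) (lam : ℕ → ℂ) (S : Finset ℕ), (⇑F : ℍ → ℂ) ≠ 0 →
      (∀ ℓ : ℕ, ℓ.Prime → ℓ ∉ S → unitsHeckeFun X.ι hO' ℓ ⇑F = fun τ => lam ℓ * F τ) →
      ∃ (Mf : ℕ) (_ : NeZero Mf) (f : CuspForm (Gamma1 Mf) 2), Mf ∣ D * M * ∏ p ∈ C.erase q, p ^ 2 ∧ IsNewform1 f ∧ nebentypus f = 1 ∧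
        ∀ ℓ : ℕ, ℓ.Prime → ℓ ∉ S → ¬ ℓ ∣ q * (D * M * ∏ p ∈ C, p) → (UpperHalfPlane.qExpansion 1 ⇑f).coeff ℓ = lam ℓ :=
    hJL.exists_newform1 D M C X q hq hO'
  have hCOMM' : ∀ (F : CuspForm (CartanCover.coverUnits X q) 2) (ℓ ℓ' : ℕ), ℓ.Prime → ℓ'.Prime → ¬ ℓ ∣ q * (D * M * ∏ p ∈ C, p) →
      ¬ ℓ' ∣ q * (D * M * ∏ p ∈ C, p) →
      unitsHeckeFun X.ι hO' ℓ (unitsHeckeFun X.ι hO' ℓ' ⇑F) = unitsHeckeFun X.ι hO' ℓ' (unitsHeckeFun X.ι hO' ℓ ⇑F) :=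
    hCOMM D M C X q hq hO'
  -- § the Hecke data as a family indexed by all of `ℕ` (a dummy datum off `P`)
  have hpack : ∀ ℓ : ℕ, ∃ p : Σ ι : Type, Fintype ι × InertHecke.HeckeDatum (CartanCover.coverUnits X q) ι, ℓ ∈ P →
      (∀ i, p.2.2.α i ∈ InertHecke.unitsHeckeSet X.ι (O := CartanCover.coverOrder X q) ℓ) ∧
      (∀ g ∈ InertHecke.unitsHeckeSet X.ι (O := CartanCover.coverOrder X q) ℓ, ∃ i, ∃ u ∈ (CartanCover.coverUnits X q), u * g = p.2.2.α i) ∧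
      ∀ x, (haveI := p.2.1; p.2.2.op χ x) = a ℓ • χ x := by
    intro ℓ
    by_cases hℓ : ℓ ∈ P
    · obtain ⟨ι, hι, H, hα, hcov, heig⟩ := hhecke ℓ (hPgood ℓ hℓ).1 (hPgood ℓ hℓ).2.1
      exact ⟨⟨ι, hι, H⟩, fun _ ↦ ⟨hα, hcov, heig⟩⟩
    · exact ⟨⟨Fin 0, inferInstance, { α := fun i ↦ i.elim0, σ := fun _ ↦ Equiv.refl _, mem := fun _ i ↦ i.elim0, disj := fun i ↦ i.elim0 }⟩,
        fun h ↦ absurd h hℓ⟩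
  choose pk hpk using hpack
  letI instFin : ∀ ℓ, Fintype (pk ℓ).1 := fun ℓ ↦ (pk ℓ).2.1
  set T : ∀ ℓ, InertHecke.HeckeDatum (CartanCover.coverUnits X q) (pk ℓ).1 := fun ℓ ↦ (pk ℓ).2.2 with hT
  have hTα : ∀ ℓ ∈ P, ∀ i, (T ℓ).α i ∈ InertHecke.unitsHeckeSet X.ι (O := CartanCover.coverOrder X q) ℓ := fun ℓ hℓ ↦ (hpk ℓ hℓ).1
  have hTcov : ∀ ℓ ∈ P, ∀ g ∈ InertHecke.unitsHeckeSet X.ι (O := CartanCover.coverOrder X q) ℓ,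
      ∃ i, ∃ u ∈ (CartanCover.coverUnits X q), u * g = (T ℓ).α i :=
    fun ℓ hℓ ↦ (hpk ℓ hℓ).2.1
  have hTeig : ∀ ℓ ∈ P, ∀ x, (T ℓ).op χ x = a ℓ • χ x := fun ℓ hℓ ↦ (hpk ℓ hℓ).2.2
  -- § the scalar mod-3 eigen-cochain and its integral lift (SIGᶜ)
  obtain ⟨ψ, hψadd, hψne, hψZ, hψeig⟩ := exists_zmod_three_cochain_of_package χ hadd h3 hne
    {x : (CartanCover.coverUnits X q) | IsOfFinOrder x ∨ Matrix.GeneralLinearGroup.IsParabolic (x : GL (Fin 2) ℝ)} (fun x hx ↦ hx.elim (hfin x) (hpar x)) T a hTeig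
  obtain ⟨u, huadd, hupar, hu⟩ := hlift 3 three_ne_zero ψ hψadd (fun γ hγ ↦ hψZ γ (Or.inl hγ)) (fun γ hγ ↦ hψZ γ (Or.inr hγ))
  -- § the Hecke operators on `S₂(Γ′)` at the primes of `P` ((H1) `T_ℓ ∈ End_ℂ S₂(Γ′)`; (H2) `φ(T_ℓ F) = T_ℓ φ(F)`)
  have hHEQ' : ∀ ℓ ∈ P, ∃ Tℓ : CuspForm (CartanCover.coverUnits X q) 2 →ₗ[ℂ] CuspForm (CartanCover.coverUnits X q) 2,
      (∀ F, ⇑(Tℓ F) = unitsHeckeFun X.ι hO' ℓ ⇑F) ∧ ∀ (F : CuspForm (CartanCover.coverUnits X q) 2) (γ : CartanCover.coverUnits X q),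
        CuspForm.rePeriod (Tℓ F) UpperHalfPlane.I γ = (T ℓ).op (CuspForm.rePeriod F UpperHalfPlane.I) γ := by
    intro ℓ hℓ
    haveI : Finite (Quotient (unitsHeckeSetoid X.ι hO' ℓ)) :=
      finite_quotient_unitsHeckeSetoid_of_cover X.ι hO' ℓ (T ℓ).α (hTα ℓ hℓ) (hTcov ℓ hℓ)
    letI : Fintype (Quotient (unitsHeckeSetoid X.ι hO' ℓ)) := Fintype.ofFinite _
    obtain ⟨Tℓ, hcoe⟩ : ∃ Tℓ : CuspForm (CartanCover.coverUnits X q) 2 →ₗ[ℂ] CuspForm (CartanCover.coverUnits X q) 2,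
        ∀ F, ⇑(Tℓ F) = unitsHeckeFun X.ι hO' ℓ ⇑F := exists_linearMap_coe_eq_unitsHeckeFun X.ι hO' ℓ
    refine ⟨Tℓ, hcoe, fun F γ ↦ ?_⟩
    have h2 : segmentIntegral (unitsHeckeFun X.ι hO' ℓ ⇑F) UpperHalfPlane.I ((γ : GL (Fin 2) ℝ) • UpperHalfPlane.I) =
        ∑ i, segmentIntegral ⇑F UpperHalfPlane.I (((T ℓ).α i * (γ : GL (Fin 2) ℝ) * ((T ℓ).α ((T ℓ).σ γ i))⁻¹) • UpperHalfPlane.I) :=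
      InertHecke.segmentIntegral_unitsHeckeFun_eq_sum X.ι hO' ℓ F (T ℓ) (hTα ℓ hℓ) (hTcov ℓ hℓ) UpperHalfPlane.I γ
    rw [InertHecke.HeckeDatum.op_apply, CuspForm.rePeriod_apply, hcoe, h2, Complex.re_sum]
    rfl
  choose! TL hTLcoe hTLper using hHEQ'
  have hTLper' : ∀ ℓ ∈ P, ∀ F : CuspForm (CartanCover.coverUnits X q) 2,
      CuspForm.rePeriod (TL ℓ F) UpperHalfPlane.I = (T ℓ).op (CuspForm.rePeriod F UpperHalfPlane.I) :=
    fun ℓ hℓ F ↦ funext (hTLper ℓ hℓ F)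
  -- § commutation of the `T_ℓ` on integer cochains, from (COMMᶜ)
  have hcomm : ∀ ℓ ∈ P, ∀ ℓ' ∈ P, ∀ x : (CartanCover.coverUnits X q) → ℤ, (∀ γ δ, x (γ * δ) = x γ + x δ) →
      (∀ γ : (CartanCover.coverUnits X q), Matrix.GeneralLinearGroup.IsParabolic (γ : GL (Fin 2) ℝ) → x γ = 0) →
      (T ℓ).op ((T ℓ').op x) = (T ℓ').op ((T ℓ).op x) := by
    intro ℓ hℓ ℓ' hℓ' x hxadd hxpar
    obtain ⟨F, hF⟩ := hESsurj (fun γ ↦ (x γ : ℝ)) (fun γ δ ↦ by rw [hxadd, Int.cast_add]) (fun γ hγ ↦ by rw [hxpar γ hγ, Int.cast_zero])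
    have hFx : CuspForm.rePeriod F UpperHalfPlane.I = (Int.castAddHom ℝ : ℤ →+ ℝ) ∘ x := funext hF
    have hTT : TL ℓ (TL ℓ' F) = TL ℓ' (TL ℓ F) := DFunLike.coe_injective (by
      rw [hTLcoe ℓ hℓ, hTLcoe ℓ' hℓ', hTLcoe ℓ' hℓ', hTLcoe ℓ hℓ]
      exact hCOMM' F ℓ ℓ' (hPgood ℓ hℓ).1 (hPgood ℓ' hℓ').1 (hPgood ℓ hℓ).2.2 (hPgood ℓ' hℓ').2.2)
    have e1 : ∀ m ∈ P, ∀ m' ∈ P, (T m).op ((T m').op ((Int.castAddHom ℝ : ℤ →+ ℝ) ∘ x)) = CuspForm.rePeriod (TL m (TL m' F)) UpperHalfPlane.I :=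
      fun m hm m' hm' ↦ by rw [← hFx, ← hTLper' m' hm', ← hTLper' m hm]
    have key := (e1 ℓ hℓ ℓ' hℓ').trans (hTT ▸ (e1 ℓ' hℓ' ℓ hℓ).symm)
    rw [show (T ℓ').op (⇑(Int.castAddHom ℝ) ∘ x) = ⇑(Int.castAddHom ℝ) ∘ (T ℓ').op x from funext (heckeOp_comp_addMonoidHom (T ℓ') _ x),
      show (T ℓ).op (⇑(Int.castAddHom ℝ) ∘ x) = ⇑(Int.castAddHom ℝ) ∘ (T ℓ).op x from funext (heckeOp_comp_addMonoidHom (T ℓ) _ x),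
      show (T ℓ).op (⇑(Int.castAddHom ℝ) ∘ (T ℓ').op x) = ⇑(Int.castAddHom ℝ) ∘ (T ℓ).op ((T ℓ').op x) from
        funext (heckeOp_comp_addMonoidHom (T ℓ) _ _),
      show (T ℓ').op (⇑(Int.castAddHom ℝ) ∘ (T ℓ).op x) = ⇑(Int.castAddHom ℝ) ∘ (T ℓ').op ((T ℓ).op x) from
        funext (heckeOp_comp_addMonoidHom (T ℓ') _ _)] at key
    funext γ
    have h := congrFun key γ
    simp only [Function.comp_apply, Int.coe_castAddHom, Int.cast_inj] at h
    exact h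
  -- § the complex joint eigen-cochain (Deligne–Serre on `Hom_par(Γ′, ℤ)`)
  obtain ⟨R, _, _, _, σ, φ, t, v, hσ, hv0, hvadd, hvpar, hveig, hφ⟩ :=
    exists_eigenCochain_lift_of_eigenCochain_mod_three (K := ℝ) T b (fun i ↦ (hb i).1) (fun i ↦ (hb i).2) huniq hcomm a ψ hψne hψeig
      u huadd hupar hu
  -- § from cochains to cusp forms: `v = v₁ + i v₂ ↦ F₁ + i F₂`
  obtain ⟨F₁, hF₁⟩ := hESsurj (fun γ ↦ (v γ).re) (fun γ δ ↦ by rw [hvadd, Complex.add_re]) (fun γ hγ ↦ by rw [hvpar γ hγ, Complex.zero_re])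
  obtain ⟨F₂, hF₂⟩ := hESsurj (fun γ ↦ (v γ).im) (fun γ δ ↦ by rw [hvadd, Complex.add_im]) (fun γ hγ ↦ by rw [hvpar γ hγ, Complex.zero_im])
  have hv₁ : CuspForm.rePeriod F₁ UpperHalfPlane.I = fun γ ↦ (v γ).re := funext hF₁
  have hv₂ : CuspForm.rePeriod F₂ UpperHalfPlane.I = fun γ ↦ (v γ).im := funext hF₂
  have hre : ∀ ℓ ∈ P, ∀ γ, (T ℓ).op (fun γ ↦ (v γ).re) γ = (σ (t ℓ)).re * (v γ).re - (σ (t ℓ)).im * (v γ).im := fun ℓ hℓ γ ↦ by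
    have h := congrFun (hveig ℓ hℓ) γ
    rw [Pi.smul_apply, smul_eq_mul] at h
    rw [InertHecke.HeckeDatum.op_apply, ← Complex.re_sum, ← InertHecke.HeckeDatum.op_apply, h, Complex.mul_re]
  have him : ∀ ℓ ∈ P, ∀ γ, (T ℓ).op (fun γ ↦ (v γ).im) γ = (σ (t ℓ)).re * (v γ).im + (σ (t ℓ)).im * (v γ).re := fun ℓ hℓ γ ↦ by
    have h := congrFun (hveig ℓ hℓ) γ
    rw [Pi.smul_apply, smul_eq_mul] at h
    rw [InertHecke.HeckeDatum.op_apply, ← Complex.im_sum, ← InertHecke.HeckeDatum.op_apply, h, Complex.mul_im]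
  have hT1 : ∀ ℓ ∈ P, TL ℓ F₁ = (σ (t ℓ)).re • F₁ - (σ (t ℓ)).im • F₂ := fun ℓ hℓ ↦
    eq_of_forall_rePeriod_eq hESinj fun γ ↦ by
      rw [hTLper ℓ hℓ, hv₁, hre ℓ hℓ, rePeriod_sub, CuspForm.rePeriod_smul, CuspForm.rePeriod_smul, hF₁, hF₂]
  have hT2 : ∀ ℓ ∈ P, TL ℓ F₂ = (σ (t ℓ)).re • F₂ + (σ (t ℓ)).im • F₁ := fun ℓ hℓ ↦
    eq_of_forall_rePeriod_eq hESinj fun γ ↦ by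
      rw [hTLper ℓ hℓ, hv₂, him ℓ hℓ, CuspForm.rePeriod_add, CuspForm.rePeriod_smul, CuspForm.rePeriod_smul, hF₁, hF₂]
  have hTG : ∀ ℓ ∈ P, TL ℓ (F₁ + Complex.I • F₂) = (σ (t ℓ)) • (F₁ + Complex.I • F₂) := fun ℓ hℓ ↦ by
    rw [(TL ℓ).map_add, (TL ℓ).map_smul, hT1 ℓ hℓ, hT2 ℓ hℓ]
    ext z
    simp only [CuspForm.coe_add, CuspForm.coe_sub, CuspForm.coe_smul, CuspForm.IsGLPos.coe_smul, Pi.add_apply, Pi.sub_apply,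
      Pi.smul_apply, Complex.real_smul, smul_eq_mul]
    apply Complex.ext
    · simp only [Complex.add_re, Complex.sub_re, Complex.mul_re, Complex.ofReal_re, Complex.ofReal_im, Complex.I_re, Complex.I_im,
        Complex.add_im, Complex.mul_im]
      ring
    · simp only [Complex.add_im, Complex.sub_im, Complex.mul_im, Complex.ofReal_re, Complex.ofReal_im, Complex.I_re, Complex.I_im,
        Complex.add_re, Complex.mul_re]
      ring
  -- § a non-zero eigenform whose eigenvalues are `τ(t_ℓ)` for an embedding `τ : R ↪ ℂ`
  have hmain : ∃ (τ : R →+* ℂ) (F : CuspForm (CartanCover.coverUnits X q) 2), Function.Injective τ ∧ (⇑F : ℍ → ℂ) ≠ 0 ∧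
      ∀ ℓ ∈ P, unitsHeckeFun X.ι hO' ℓ ⇑F = fun z ↦ τ (t ℓ) * F z := by
    by_cases hG0 : (⇑(F₁ + Complex.I • F₂) : ℍ → ℂ) = 0
    · -- `F₁ + i F₂ = 0`: then `F₂ = i F₁`, `F₁ ≠ 0` and `T_ℓ F₁ = conj(σ t_ℓ) F₁`
      have hF₂I : F₂ = Complex.I • F₁ := by
        ext z
        have h := congrFun hG0 z
        rw [CuspForm.coe_add, CuspForm.IsGLPos.coe_smul, Pi.add_apply, Pi.smul_apply, smul_eq_mul, Pi.zero_apply] at h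
        rw [CuspForm.IsGLPos.coe_smul, Pi.smul_apply, smul_eq_mul]
        linear_combination (-Complex.I) * h + (F₂ z) * Complex.I_sq
      have hF₁0 : (⇑F₁ : ℍ → ℂ) ≠ 0 := by
        intro h0
        have hF₁' : F₁ = 0 := DFunLike.coe_injective (by rw [h0, CuspForm.coe_zero])
        have hF₂' : F₂ = 0 := by rw [hF₂I, hF₁', smul_zero]
        apply hv0
        funext γ
        apply Complex.ext
        · rw [← hF₁ γ, hF₁', rePeriod_zero]; rfl
        · rw [← hF₂ γ, hF₂', rePeriod_zero]; rfl
      refine ⟨(starRingEnd ℂ).comp σ, F₁, (starRingEnd ℂ).injective.comp hσ, hF₁0, fun ℓ hℓ ↦ ?_⟩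
      have h1 : TL ℓ F₁ = ((starRingEnd ℂ) (σ (t ℓ))) • F₁ := by
        rw [hT1 ℓ hℓ, hF₂I]
        ext z
        simp only [CuspForm.coe_sub, CuspForm.coe_smul, CuspForm.IsGLPos.coe_smul, Pi.sub_apply, Pi.smul_apply, Complex.real_smul,
          smul_eq_mul]
        apply Complex.ext
        · simp only [Complex.sub_re, Complex.mul_re, Complex.ofReal_re, Complex.ofReal_im, Complex.I_re, Complex.I_im, Complex.conj_re,
            Complex.conj_im, Complex.mul_im]
          ring
        · simp only [Complex.sub_im, Complex.mul_im, Complex.ofReal_re, Complex.ofReal_im, Complex.I_re, Complex.I_im, Complex.conj_re,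
            Complex.conj_im, Complex.mul_re]
          ring
      rw [← hTLcoe ℓ hℓ, h1]
      funext z
      rw [RingHom.coe_comp, Function.comp_apply, CuspForm.IsGLPos.coe_smul, Pi.smul_apply, smul_eq_mul]
    · refine ⟨σ, F₁ + Complex.I • F₂, hσ, hG0, fun ℓ hℓ ↦ ?_⟩
      rw [← hTLcoe ℓ hℓ, hTG ℓ hℓ]
      funext z
      rw [CuspForm.IsGLPos.coe_smul, Pi.smul_apply, smul_eq_mul]
  obtain ⟨τ, F, hτ, hF0, heigF⟩ := hmain
  -- § Jacquet–Langlands: the newform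
  obtain ⟨Mf, hMf, f, hdvd, hnew, hε, hcoef⟩ := hJL' F (fun ℓ ↦ τ (t ℓ)) S₁ hF0 (fun ℓ hℓ hS ↦ heigF ℓ ⟨hℓ, hS⟩)
  haveI : NeZero Mf := hMf
  haveI : NumberField (coeffCharField f) := Literature.NumberTheory.EllipticCurves.GreenbergSelmer.numberField_coeffCharField_of_isNewform1 hnew
  -- § the order `ℤ[t_ℓ : ℓ ∈ P] ⊆ R`, embedded in `K_f`, and a maximal ideal over `3` compatible with `φ`
  set R' : Subalgebra ℤ R := Algebra.adjoin ℤ (t '' P) with hR'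
  haveI : Module.Finite ℤ R' := Module.Finite.of_injective R'.val.toLinearMap Subtype.val_injective
  set τ' : R' →+* ℂ := τ.comp R'.val.toRingHom with hτ'
  have hτ'inj : Function.Injective τ' := hτ.comp Subtype.val_injective
  set φ' : R' →+* ℤ ⧸ (Ideal.span {(3 : ℤ)} : Ideal ℤ) := φ.comp R'.val.toRingHom with hφ'
  have hK : ∀ x ∈ Algebra.adjoin ℤ (t '' P), τ x ∈ coeffCharField f := by
    intro x hx
    induction hx using Algebra.adjoin_induction with
    | mem x hx =>
      obtain ⟨ℓ, hℓ, rfl⟩ := hx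
      rw [← hcoef ℓ (hPgood ℓ hℓ).1 hℓ.2 (hPgood ℓ hℓ).2.2]
      exact cuspCoeff_mem_coeffCharField f ℓ
    | algebraMap n =>
      rw [Algebra.algebraMap_eq_smul_one, map_zsmul, map_one]
      exact zsmul_mem (one_mem _) n
    | add x y _ _ hx hy => rw [map_add]; exact add_mem hx hy
    | mul x y _ _ hx hy => rw [map_mul]; exact mul_mem hx hy
  obtain ⟨j, 𝔐, h𝔐, hj, h3𝔐, hcong⟩ :=
    exists_maximal_ideal_over_ker (coeffCharField f) τ' hτ'inj (fun x ↦ hK x.1 x.2) Nat.prime_three φ'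
  -- § the residue field `k = 𝓞_{K_f} / 𝔐` (characteristic `3`, discrete)
  haveI : 𝔐.IsMaximal := h𝔐
  letI kF : Field (↥(coeffCharIntegers f) ⧸ 𝔐) := Ideal.Quotient.field 𝔐
  have h3k : ((3 : ℕ) : ↥(coeffCharIntegers f) ⧸ 𝔐) = 0 := by
    rw [← map_natCast (Ideal.Quotient.mk 𝔐), Ideal.Quotient.eq_zero_iff_mem]
    exact h3𝔐
  haveI : CharP (↥(coeffCharIntegers f) ⧸ 𝔐) 3 := (CharP.charP_iff_prime_eq_zero Nat.prime_three).mpr h3k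
  letI kT : TopologicalSpace (↥(coeffCharIntegers f) ⧸ 𝔐) := ⊥
  refine ⟨Mf, hMf, f, hnew, ↥(coeffCharIntegers f) ⧸ 𝔐, kF, kT, ⟨rfl⟩, ZMod.castHom (dvd_refl 3) _, Ideal.Quotient.mk 𝔐, hdvd, ?_⟩
  -- § the integral Hecke polynomials at the primes of `P` (all but finitely many)
  rw [Filter.eventually_cofinite]
  refine ((S₁.finite_toSet).preimage Nat.Primes.coe_nat_injective.injOn).subset fun ℓ hℓ ↦ ?_
  by_contra hS
  apply hℓ
  have hℓP : (ℓ : ℕ) ∈ P := ⟨ℓ.2, hS⟩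
  set tl : R' := ⟨t ℓ, Algebra.subset_adjoin ⟨ℓ, hℓP, rfl⟩⟩ with htl
  set α : ↥(coeffCharIntegers f) := j tl with hα
  have hαC : ((α : coeffCharField f) : ℂ) = (UpperHalfPlane.qExpansion 1 ⇑f).coeff ℓ := by
    rw [hα, hj]
    exact (hcoef ℓ ℓ.2 hS (hPgood ℓ hℓP).2.2).symm
  have hα𝔐 : α - ((a ℓ : ℤ) : ↥(coeffCharIntegers f)) ∈ 𝔐 := hcong tl (a ℓ) (hφ ℓ hℓP)
  have hℓMf : ¬ (ℓ : ℕ) ∣ Mf := fun h ↦ (hPgood ℓ hℓP).2.2 (dvd_of_dvd_newformLevel ℓ.2 hdvd h)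
  refine ⟨Polynomial.X ^ 2 - Polynomial.C α * Polynomial.X + Polynomial.C ((ℓ : ℕ) : ↥(coeffCharIntegers f)), ?_, ?_⟩
  · apply Polynomial.map_injective (algebraMap (coeffCharField f) ℂ) (algebraMap (coeffCharField f) ℂ).injective
    rw [Polynomial.map_map, map_heckePolynomial]
    have hεp : (nebentypus f ((ℓ : ℕ) : ZMod Mf) : ℂ) * ((ℓ : ℕ) : ℂ) ^ ((2 : ℤ) - 1) = (ℓ : ℕ) := by
      rw [hε, MulChar.one_apply ((ZMod.isUnit_prime_iff_not_dvd ℓ.2).mpr hℓMf)]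
      norm_num
    have hαC' : ((algebraMap (coeffCharField f) ℂ).comp (algebraMap ↥(coeffCharIntegers f) (coeffCharField f))) α =
        (UpperHalfPlane.qExpansion 1 ⇑f).coeff ℓ := by
      rw [← hαC]
      rfl
    rw [hεp, Polynomial.map_add, Polynomial.map_sub, Polynomial.map_mul, Polynomial.map_pow, Polynomial.map_X, Polynomial.map_C,
      Polynomial.map_C, map_natCast, hαC']
  · have e : Ideal.Quotient.mk 𝔐 α = ((a ℓ : ℤ) : ↥(coeffCharIntegers f) ⧸ 𝔐) := by
      have h1 : Ideal.Quotient.mk 𝔐 α = Ideal.Quotient.mk 𝔐 ((a ℓ : ℤ) : ↥(integralClosure ℤ ↥(coeffCharField f))) := Ideal.Quotient.eq.mpr hα𝔐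
      rw [h1, map_intCast]
    simp only [Polynomial.map_add, Polynomial.map_sub, Polynomial.map_mul, Polynomial.map_pow, Polynomial.map_X, Polynomial.map_C,
      map_natCast, map_intCast]
    erw [e]
    simp only [map_intCast, Polynomial.map_natCast]

end Summit.BirchSwinnertonDyer.BirchSwinnertonDyer.Theorems.CartanCarayol

end
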